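import Summits.CriticalPhenomena.PercolationContinuityZ3.Theorems.Transplant.LineGraphSiteContinuity
import Summits.CriticalPhenomena.PercolationContinuityZ3.Theorems.Transplant.DiamondLattice
import Summits.CriticalPhenomena.PercolationContinuityZ3.Theorems.Transplant.SiteBenjaminiSchrammKnownCases
import Literature.Probability.Percolation.CerfTwoArmsProofs
import Mathlib.Tactic.FinCases
import Mathlib.Tactic.Linarith
import HarnessLib

/-!
# The PYROCHLORE lattice in coordinates: `2D₃ + {0, (0,1,1), (1,0,1), (1,1,0)} ⊂ ℤ³` with nearest-neighbour bonds IS the line graph of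
# the diamond lattice; SITE percolation on it dies at its own critical point (class C1b, input substitution)

builds on p205010 (kernel theorem, internal audit signed; external expert review pending).
Status sentence (coordinator 2026-08-20T04:30Z): "θ(p_c) = 0 on ℤ^d, all d ≥ 2 — kernel-verified (Lean 4/Mathlib,
standard axioms); internal adversarial audit SIGNED 2026-08-20 04:29Z; external expert review pending."

Lane `prim-bschramm-*`, seat `prim-bschramm-p2` (gen 13).  Companion of `LineGraphSiteContinuity.lean` (the Fisher–Essam / Kesten
covering-graph device), which proves the site theorem for the ABSTRACT line graph `diamondGraph.lineGraph`.  Here the pyrochlore lattice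
is DEFINED IN TREE VOCABULARY as a point set with a distance graph, exactly like `fccGraph`/`bccGraph`/`diamondGraph`
(`StatementCubicLattices.lean`, `DiamondLattice.lean`), and PROVED isomorphic to `diamondGraph.lineGraph`:
* `pyrochloreSite = {m ∈ ℤ³ : m₀+m₁+m₂ even and ⌊m₀/2⌋+⌊m₁/2⌋+⌊m₂/2⌋ even}` — the union of the four cosets `0, (0,1,1), (1,0,1), (1,1,0)`
  of `2D₃ = {x : xᵢ even, Σxᵢ ≡ 0 (4)}` (the fcc lattice with cubic cell `4` and its standard 4-point pyrochlore basis `(0,0,0),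
  (0,¼,¼), (¼,0,¼), (¼,¼,0)·4`); a subset of the fcc lattice `fccSite = D₃ = {Σ even}` containing every second fcc site
  (`pyrochloreSite_subset_fccSite`).  `pyrochloreGraph := (distSqGraph 3 2).induce pyrochloreSite` — nearest neighbours at squared
  distance `2`, six per site (e.g. `±(0,1,1), ±(1,0,1), ±(1,1,0)` at the origin), forming corner-sharing tetrahedra.
* In the tree's diamond frame (`diamondSite = 2D₃ ∪ (2D₃ + (1,1,1))`, bonds `(±1,±1,±1)`) the bond `{x, y}` has midpoint `(x+y)/2` with
  all coordinates in `ℤ + ½`; `midOf {x,y} := (x + y − (1,1,1))/2 ∈ pyrochloreSite`, and conversely the site `m` is the midpoint of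
  the bond `edgeOf m = {lo m, hi m}`, `lo m = 2⌈m/2⌉` (the even endpoint), `hi m = 2⌊m/2⌋ + (1,1,1)` (the odd endpoint).  Two sites are
  nearest neighbours iff their bonds share an endpoint (`lo m = lo m'` — all `⌈mᵢ/2⌉` agree — or `hi m = hi m'` — all `⌊mᵢ/2⌋` agree):
  **`pyrochloreIso : pyrochloreGraph ≃g diamondGraph.lineGraph`**.  This is the crystallographic statement "the pyrochlore lattice is
  the bisimplex (medial / covering) lattice of the diamond lattice" (Henley 2001 §1).
* **`pyrochlore_siteCriticalContinuity : ∀ m, θ^{site}_{pyrochlore}(m, p_c^{site}(pyrochlore, m)) = 0`**, `p_c^{site}(pyrochlore) =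
  p_c^{bond}(diamond) ≤ 1/2`, and a.s. no infinite open site cluster at that density — transported along `pyrochloreIso` from
  `diamondLineGraph_siteCriticalContinuity` (builds on p205010 (kernel theorem, internal audit signed; external expert review pending)).
  Not in print.
[cite: Henley2001, §1 (bisimplex lattices: pyrochlore ← diamond)] [cite: ConwaySloane1999, Ch. 4 §7.1 (D₃ = fcc) and §7.3 (diamond)]
[cite: Kesten1982, §2.5 and §3.1 Prop. 3.1] [cite: BenjaminiSchramm1996, Conj. 4]
-/

noncomputable section

namespace Summit.CriticalPhenomena.PercolationContinuityZ3.Theorems.Transplant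

open MeasureTheory Literature.Probability.Percolation Literature.Probability.LatticeModels SimpleGraph

/-! ## §1 The point set and the graph -/

/-- **The vertex set of the pyrochlore lattice**: `m₀+m₁+m₂` even and `⌊m₀/2⌋+⌊m₁/2⌋+⌊m₂/2⌋` even (Lean's `Int` division `/ 2` is the
floor); equivalently `2D₃ + {0, (0,1,1), (1,0,1), (1,1,0)}`. [cite: Henley2001, §1] [cite: ConwaySloane1999, Ch. 4 §7.1] -/
def pyrochloreSite : Set (Site 3) :=
  {m | (m 0 + m 1 + m 2) % 2 = 0 ∧ (m 0 / 2 + m 1 / 2 + m 2 / 2) % 2 = 0}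

/-- Membership in `pyrochloreSite`. [folklore] -/
theorem mem_pyrochloreSite_iff (m : Site 3) :
    m ∈ pyrochloreSite ↔ (m 0 + m 1 + m 2) % 2 = 0 ∧ (m 0 / 2 + m 1 / 2 + m 2 / 2) % 2 = 0 := Iff.rfl

/-- The origin is a pyrochlore site. [folklore] -/
theorem zero_mem_pyrochloreSite : (0 : Site 3) ∈ pyrochloreSite := by
  simp [mem_pyrochloreSite_iff]

/-- **Pyrochlore sites are fcc sites** (`Σ mᵢ` even): the pyrochlore lattice is the fcc lattice `D₃` with every second site deleted,
keeping the nearest-neighbour bonds. [cite: ConwaySloane1999, Ch. 4 §7.1 (D₃ = fcc)] -/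
theorem pyrochloreSite_subset_fccSite : pyrochloreSite ⊆ fccSite := by
  intro m hm
  rw [mem_fccSite_iff, Int.even_iff]
  exact hm.1

/-- **The pyrochlore lattice as a graph**: pyrochlore sites at squared distance `2` (the fcc nearest-neighbour bonds `±eᵢ±eⱼ`
between pyrochlore sites) — corner-sharing tetrahedra. [cite: Henley2001, §1] -/
def pyrochloreGraph : SimpleGraph pyrochloreSite :=
  (distSqGraph 3 2).induce pyrochloreSite

/-- The origin of the pyrochlore lattice. [folklore] -/
def pyrochloreOrigin : pyrochloreSite := ⟨0, zero_mem_pyrochloreSite⟩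

/-- Adjacency in the pyrochlore lattice: distinct sites at squared distance `2`. [folklore] -/
theorem pyrochloreGraph_adj (m m' : pyrochloreSite) :
    pyrochloreGraph.Adj m m' ↔ (m : Site 3) ≠ m' ∧ ∑ i, ((m : Site 3) i - (m' : Site 3) i) ^ 2 = 2 := Iff.rfl

/-- The pyrochlore lattice is locally finite. [folklore] -/
instance pyrochloreGraph_locallyFinite : pyrochloreGraph.LocallyFinite := distSqGraph_induce_locallyFinite 3 2 pyrochloreSite

/-- Two points of `ℤ³` are equal iff their three coordinates are. [folklore] -/
private theorem site3_eq_iff (a b : Site 3) : a = b ↔ a 0 = b 0 ∧ a 1 = b 1 ∧ a 2 = b 2 :=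
  ⟨fun h => by simp [h], fun h => funext fun i => by fin_cases i <;> simp [h.1, h.2.1, h.2.2]⟩

/-- An integer whose square is at most `2` is `-1`, `0` or `1`. [folklore] -/
private theorem eq_of_sq_le_two {t : ℤ} (h : t ^ 2 ≤ 2) : t = -1 ∨ t = 0 ∨ t = 1 := by
  rcases le_or_gt t 1 with h1 | h1
  · rcases le_or_gt (-1) t with h2 | h2
    · omega
    · exfalso
      have h3 : t ≤ -2 := by omega
      nlinarith
  · exfalso
    have h3 : 2 ≤ t := by omega
    nlinarith

/-! ## §2 The two diamond endpoints of a pyrochlore site and the midpoint of a diamond bond -/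

/-- The EVEN endpoint `2⌈m/2⌉` of the diamond bond whose midpoint is the pyrochlore site `m`. [cite: Henley2001, §1] -/
def loEnd (m : Site 3) : Site 3 := fun i => 2 * ((m i + 1) / 2)

/-- The ODD endpoint `2⌊m/2⌋ + (1,1,1)` of the diamond bond whose midpoint is the pyrochlore site `m`. [cite: Henley2001, §1] -/
def hiEnd (m : Site 3) : Site 3 := fun i => 2 * (m i / 2) + 1

/-- Coordinates of `loEnd`. [folklore] -/
@[simp] theorem loEnd_apply (m : Site 3) (i : Fin 3) : loEnd m i = 2 * ((m i + 1) / 2) := rfl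

/-- Coordinates of `hiEnd`. [folklore] -/
@[simp] theorem hiEnd_apply (m : Site 3) (i : Fin 3) : hiEnd m i = 2 * (m i / 2) + 1 := rfl

/-- The even endpoint is a diamond site (all coordinates even, sum `≡ 0 (mod 4)` by the two parity conditions). [cite: ConwaySloane1999, Ch. 4 §7.3] -/
theorem loEnd_mem {m : Site 3} (hm : m ∈ pyrochloreSite) : loEnd m ∈ diamondSite := by
  rw [mem_pyrochloreSite_iff] at hm
  rw [mem_diamondSite_iff]
  simp only [loEnd_apply]
  omega

/-- The odd endpoint is a diamond site (all coordinates odd, sum `≡ 3 (mod 4)`). [cite: ConwaySloane1999, Ch. 4 §7.3] -/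
theorem hiEnd_mem {m : Site 3} (hm : m ∈ pyrochloreSite) : hiEnd m ∈ diamondSite := by
  rw [mem_pyrochloreSite_iff] at hm
  rw [mem_diamondSite_iff]
  simp only [hiEnd_apply]
  omega

/-- The two endpoints differ (even vs odd first coordinate). [folklore] -/
theorem loEnd_ne_hiEnd (m m' : Site 3) : loEnd m ≠ hiEnd m' := by
  intro h
  have h0 := congrFun h 0
  simp only [loEnd_apply, hiEnd_apply] at h0
  omega

/-- The two endpoints form a diamond bond: every coordinate differs by `±1`. [cite: ConwaySloane1999, Ch. 4 §7.3] -/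
theorem loEnd_adj_hiEnd {m : Site 3} (hm : m ∈ pyrochloreSite) :
    diamondGraph.Adj ⟨loEnd m, loEnd_mem hm⟩ ⟨hiEnd m, hiEnd_mem hm⟩ := by
  rw [diamondGraph_adj']
  refine ⟨loEnd_ne_hiEnd m m, ?_⟩
  simp only [Fin.sum_univ_three, loEnd_apply, hiEnd_apply]
  have h : ∀ i : Fin 3, (2 * ((m i + 1) / 2) - (2 * (m i / 2) + 1)) ^ 2 = 1 := fun i => by
    rcases Int.emod_two_eq_zero_or_one (m i) with hi | hi
    · have : 2 * ((m i + 1) / 2) - (2 * (m i / 2) + 1) = -1 := by omega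
      rw [this]; norm_num
    · have : 2 * ((m i + 1) / 2) - (2 * (m i / 2) + 1) = 1 := by omega
      rw [this]; norm_num
  rw [h 0, h 1, h 2]; norm_num

/-- **The diamond bond of a pyrochlore site**, as a vertex of the line graph `diamondGraph.lineGraph`. [cite: Henley2001, §1] -/
def edgeOf (m : pyrochloreSite) : diamondGraph.edgeSet :=
  ⟨s(⟨loEnd m, loEnd_mem m.2⟩, ⟨hiEnd m, hiEnd_mem m.2⟩), (mem_edgeSet _).2 (loEnd_adj_hiEnd m.2)⟩

/-- `edgeOf m` is the unordered pair `{lo m, hi m}`. [folklore] -/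
@[simp] theorem coe_edgeOf (m : pyrochloreSite) :
    ((edgeOf m : diamondGraph.edgeSet) : Sym2 diamondSite) = s(⟨loEnd m, loEnd_mem m.2⟩, ⟨hiEnd m, hiEnd_mem m.2⟩) := rfl

/-- The (shifted, scaled) midpoint `(x + y − (1,1,1))/2` of a pair of diamond sites — symmetric in the pair. [cite: Henley2001, §1] -/
def midFun : Sym2 diamondSite → Site 3 :=
  Sym2.lift ⟨fun x y => fun i => ((x : Site 3) i + (y : Site 3) i - 1) / 2, fun x y => by
    funext i
    dsimp only
    rw [add_comm]⟩

/-- `midFun` on a pair. [folklore] -/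
@[simp] theorem midFun_mk (x y : diamondSite) :
    midFun s(x, y) = fun i => ((x : Site 3) i + (y : Site 3) i - 1) / 2 := rfl

/-- Along a diamond bond every coordinate changes by `±1` (as a disjunction, for `omega`). [cite: ConwaySloane1999, Ch. 4 §7.3] -/
theorem diamond_sub_eq_or {x y : diamondSite} (h : diamondGraph.Adj x y) (i : Fin 3) :
    (x : Site 3) i - (y : Site 3) i = 1 ∨ (x : Site 3) i - (y : Site 3) i = -1 :=
  (abs_eq (by norm_num : (0 : ℤ) ≤ 1)).1 (diamond_abs_sub_eq_one h i)

/-- **The midpoint of a diamond bond is a pyrochlore site.** [cite: Henley2001, §1 (bisimplex lattices)] -/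
theorem midFun_mem (e : diamondGraph.edgeSet) : midFun (e : Sym2 diamondSite) ∈ pyrochloreSite := by
  obtain ⟨e, he⟩ := e
  induction e using Sym2.ind with
  | h x y =>
    have hadj : diamondGraph.Adj x y := (mem_edgeSet _).1 he
    have h0 := diamond_sub_eq_or hadj 0
    have h1 := diamond_sub_eq_or hadj 1
    have h2 := diamond_sub_eq_or hadj 2
    have hx := (mem_diamondSite_iff _).1 x.2
    have hy := (mem_diamondSite_iff _).1 y.2
    simp only [midFun_mk, mem_pyrochloreSite_iff]
    omega

/-- **The pyrochlore site of a diamond bond** (its midpoint). [cite: Henley2001, §1] -/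
def midOf (e : diamondGraph.edgeSet) : pyrochloreSite := ⟨midFun (e : Sym2 diamondSite), midFun_mem e⟩

/-- Coordinates of `midOf`. [folklore] -/
@[simp] theorem coe_midOf (e : diamondGraph.edgeSet) : ((midOf e : pyrochloreSite) : Site 3) = midFun (e : Sym2 diamondSite) := rfl

/-! ## §3 The bijection `pyrochloreSite ≃ E(diamond)` -/

/-- The midpoint of the bond of `m` is `m`. [cite: Henley2001, §1] -/
theorem midOf_edgeOf (m : pyrochloreSite) : midOf (edgeOf m) = m := by
  apply Subtype.ext
  simp only [coe_midOf, coe_edgeOf, midFun_mk]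
  funext i
  simp only [loEnd_apply, hiEnd_apply]
  omega

/-- The bond of the midpoint of the bond `{x, y}` is `{x, y}`: the even endpoint is recovered as `2⌈m/2⌉`, the odd one as `2⌊m/2⌋+1`.
[cite: Henley2001, §1] -/
theorem edgeOf_midOf (e : diamondGraph.edgeSet) : edgeOf (midOf e) = e := by
  obtain ⟨e, he⟩ := e
  apply Subtype.ext
  simp only [coe_edgeOf]
  induction e using Sym2.ind with
  | h x y =>
    have hadj : diamondGraph.Adj x y := (mem_edgeSet _).1 he
    have h0 := diamond_sub_eq_or hadj 0
    have h1 := diamond_sub_eq_or hadj 1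
    have h2 := diamond_sub_eq_or hadj 2
    obtain ⟨hxa, hxb, -⟩ := (mem_diamondSite_iff _).1 x.2
    obtain ⟨hya, hyb, -⟩ := (mem_diamondSite_iff _).1 y.2
    change s((⟨loEnd (midFun s(x, y)), _⟩ : diamondSite), ⟨hiEnd (midFun s(x, y)), _⟩) = s(x, y)
    rcases Int.emod_two_eq_zero_or_one ((x : Site 3) 0) with hx0 | hx0
    · -- `x` is the even endpoint
      have hlo : loEnd (midFun s(x, y)) = (x : Site 3) := by
        rw [site3_eq_iff]; simp only [loEnd_apply, midFun_mk]; omega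
      have hhi : hiEnd (midFun s(x, y)) = (y : Site 3) := by
        rw [site3_eq_iff]; simp only [hiEnd_apply, midFun_mk]; omega
      have e1 : (⟨loEnd (midFun s(x, y)), loEnd_mem (midFun_mem ⟨s(x, y), he⟩)⟩ : diamondSite) = x := Subtype.ext hlo
      have e2 : (⟨hiEnd (midFun s(x, y)), hiEnd_mem (midFun_mem ⟨s(x, y), he⟩)⟩ : diamondSite) = y := Subtype.ext hhi
      rw [e1, e2]
    · -- `y` is the even endpoint
      have hlo : loEnd (midFun s(x, y)) = (y : Site 3) := by
        rw [site3_eq_iff]; simp only [loEnd_apply, midFun_mk]; omega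
      have hhi : hiEnd (midFun s(x, y)) = (x : Site 3) := by
        rw [site3_eq_iff]; simp only [hiEnd_apply, midFun_mk]; omega
      have e1 : (⟨loEnd (midFun s(x, y)), loEnd_mem (midFun_mem ⟨s(x, y), he⟩)⟩ : diamondSite) = y := Subtype.ext hlo
      have e2 : (⟨hiEnd (midFun s(x, y)), hiEnd_mem (midFun_mem ⟨s(x, y), he⟩)⟩ : diamondSite) = x := Subtype.ext hhi
      rw [e1, e2, Sym2.eq_swap]

/-- **Pyrochlore sites ↔ diamond bonds**, the bijection underlying the isomorphism. [cite: Henley2001, §1] -/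
def pyrochloreEquiv : pyrochloreSite ≃ diamondGraph.edgeSet where
  toFun := edgeOf
  invFun := midOf
  left_inv := midOf_edgeOf
  right_inv := edgeOf_midOf

/-! ## §4 Adjacency: nearest pyrochlore neighbours ↔ bonds sharing a diamond site -/

set_option maxHeartbeats 400000 in
/-- **The arithmetic heart.**  For pyrochlore sites `m ≠ m'`: squared distance `2` iff all `⌈mᵢ/2⌉` agree (common EVEN endpoint) or all
`⌊mᵢ/2⌋` agree (common ODD endpoint).  (⇒: exactly two coordinates differ, by `±1`; the parity of `Σ⌊mᵢ/2⌋` decides whether the floors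
or the ceilings agree there.  ⇐: the differences are in `{0, ±1}` and `Σ mᵢ ≡ Σ m'ᵢ (mod 2)` makes their number even.)
[cite: Henley2001, §1 (bisimplex lattices)] -/
theorem pyrochlore_distSq_two_iff {m m' : Site 3} (hm : m ∈ pyrochloreSite) (hm' : m' ∈ pyrochloreSite) (hne : m ≠ m') :
    ∑ i, (m i - m' i) ^ 2 = 2 ↔ (loEnd m = loEnd m' ∨ hiEnd m = hiEnd m') := by
  rw [mem_pyrochloreSite_iff] at hm hm'
  rw [Ne, site3_eq_iff] at hne
  simp only [Fin.sum_univ_three, site3_eq_iff, loEnd_apply, hiEnd_apply]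
  constructor
  · intro hs
    have hb0 : (m 0 - m' 0) ^ 2 ≤ 2 := by nlinarith [sq_nonneg (m 1 - m' 1), sq_nonneg (m 2 - m' 2)]
    have hb1 : (m 1 - m' 1) ^ 2 ≤ 2 := by nlinarith [sq_nonneg (m 0 - m' 0), sq_nonneg (m 2 - m' 2)]
    have hb2 : (m 2 - m' 2) ^ 2 ≤ 2 := by nlinarith [sq_nonneg (m 0 - m' 0), sq_nonneg (m 1 - m' 1)]
    rcases eq_of_sq_le_two hb0 with h0 | h0 | h0 <;> rcases eq_of_sq_le_two hb1 with h1 | h1 | h1 <;>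
      rcases eq_of_sq_le_two hb2 with h2 | h2 | h2 <;> rw [h0, h1, h2] at hs <;> norm_num at hs <;> omega
  · intro hend
    have h0 : m 0 - m' 0 = -1 ∨ m 0 - m' 0 = 0 ∨ m 0 - m' 0 = 1 := by omega
    have h1 : m 1 - m' 1 = -1 ∨ m 1 - m' 1 = 0 ∨ m 1 - m' 1 = 1 := by omega
    have h2 : m 2 - m' 2 = -1 ∨ m 2 - m' 2 = 0 ∨ m 2 - m' 2 = 1 := by omega
    rcases h0 with h0 | h0 | h0 <;> rcases h1 with h1 | h1 | h1 <;> rcases h2 with h2 | h2 | h2 <;>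
      rw [h0, h1, h2] <;> norm_num <;> omega

/-- **Nearest pyrochlore neighbours are exactly the pairs of diamond bonds sharing an endpoint.** [cite: Henley2001, §1] -/
theorem edgeOf_adj_iff (m m' : pyrochloreSite) :
    diamondGraph.lineGraph.Adj (edgeOf m) (edgeOf m') ↔ pyrochloreGraph.Adj m m' := by
  rw [lineGraph_adj_iff_exists, pyrochloreGraph_adj]
  have hinj : edgeOf m ≠ edgeOf m' ↔ (m : Site 3) ≠ m' := by
    rw [not_iff_not]
    constructor
    · intro h
      have := congrArg midOf h
      rw [midOf_edgeOf, midOf_edgeOf] at this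
      rw [this]
    · intro h
      rw [Subtype.ext h]
  rw [hinj]
  refine and_congr_right fun hne => ?_
  rw [pyrochlore_distSq_two_iff m.2 m'.2 hne]
  simp only [coe_edgeOf, Sym2.mem_iff]
  constructor
  · rintro ⟨v, hv | hv, hv' | hv'⟩ <;> subst hv
    · exact Or.inl (congrArg Subtype.val hv')
    · exact absurd (congrArg Subtype.val hv') (loEnd_ne_hiEnd _ _)
    · exact absurd (congrArg Subtype.val hv').symm (loEnd_ne_hiEnd _ _)
    · exact Or.inr (congrArg Subtype.val hv')
  · rintro (h | h)
    · exact ⟨⟨loEnd m, loEnd_mem m.2⟩, Or.inl rfl, Or.inl (Subtype.ext h)⟩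
    · exact ⟨⟨hiEnd m, hiEnd_mem m.2⟩, Or.inr rfl, Or.inr (Subtype.ext h)⟩

/-- **THE PYROCHLORE LATTICE IS THE LINE GRAPH OF THE DIAMOND LATTICE** (corner-sharing tetrahedra ↔ bonds at a common diamond site).
[cite: Henley2001, §1 (bisimplex lattices)] [cite: Kesten1982, §2.5 Def. 2.13] -/
def pyrochloreIso : pyrochloreGraph ≃g diamondGraph.lineGraph where
  toEquiv := pyrochloreEquiv
  map_rel_iff' := fun {a b} => edgeOf_adj_iff a b

/-- `pyrochloreIso m = edgeOf m`. [folklore] -/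
@[simp] theorem pyrochloreIso_apply (m : pyrochloreSite) : pyrochloreIso m = edgeOf m := rfl

/-! ## §5 Site percolation on the pyrochlore lattice at its own critical point -/

/-- **THEOREM: site percolation on the pyrochlore lattice dies at its own critical point**, `θ^{site}_{pyrochlore}(m, p_c^{site}(pyrochlore, m))
= 0` at every site `m` — transported along `pyrochloreIso` from `diamondLineGraph_siteCriticalContinuity` (Fisher–Essam/Kesten
covering-graph equivalence + `diamond_criticalContinuity_holds`); builds on p205010 (kernel theorem, internal audit signed; external expert
review pending).  An instance of Benjamini–Schramm's Conjecture 4 for SITE percolation on a vertex-transitive lattice; not in print.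
[cite: BenjaminiSchramm1996, Conj. 4] [cite: Henley2001, §1] [cite: Kesten1982, §3.1 Prop. 3.1] -/
theorem pyrochlore_siteCriticalContinuity (m : pyrochloreSite) :
    siteTheta pyrochloreGraph m (siteCriticalProbIOf pyrochloreGraph m) = 0 := by
  have hθ := siteTheta_iso pyrochloreIso (siteCriticalProbIOf pyrochloreGraph m) m
  have hpc : siteCriticalProbIOf pyrochloreGraph m = siteCriticalProbIOf diamondGraph.lineGraph (pyrochloreIso m) :=
    Subtype.ext (SiteKnownCases.siteCriticalProb_iso pyrochloreIso m).symm
  rw [← hθ, hpc]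
  exact diamondLineGraph_siteCriticalContinuity _

/-- **`p_c^{site}(pyrochlore, m) = p_c^{bond}(diamond)`** at every site (Fisher–Essam identity along the isomorphism).
[cite: FisherEssam1961, §2] [cite: Henley2001, §1 and Table 1] -/
theorem siteCriticalProbIOf_pyrochlore_eq (m : pyrochloreSite) :
    siteCriticalProbIOf pyrochloreGraph m = criticalProbIOf diamondGraph diamondOrigin := by
  rw [← siteCriticalProbIOf_diamondLineGraph_eq (pyrochloreIso m)]
  exact Subtype.ext (SiteKnownCases.siteCriticalProb_iso pyrochloreIso m).symm

/-- `p_c^{site}(pyrochlore) ≤ 1/2` (`< 1`: the critical value is not degenerate; tree `criticalProb_diamond_le_half`). [cite: Henley2001, Table 1] -/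
theorem siteCriticalProb_pyrochlore_le_half (m : pyrochloreSite) : siteCriticalProb pyrochloreGraph m ≤ 1 / 2 := by
  have h := congrArg Subtype.val (siteCriticalProbIOf_pyrochlore_eq m)
  simp only [coe_siteCriticalProbIOf] at h
  rw [h]
  exact criticalProb_diamond_le_half

/-- **At `p_c^{site}(pyrochlore)` there is a.s. NO infinite open site cluster anywhere on the pyrochlore lattice.**
[cite: BenjaminiSchramm1996, Conj. 4] [cite: Henley2001, §1] -/
theorem pyrochlore_noInfiniteSiteCluster :
    (sitePercolation pyrochloreSite (criticalProbIOf diamondGraph diamondOrigin)).real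
      {ξ | ∃ m : pyrochloreSite, ξ ∈ sitePercolatesAt pyrochloreGraph m} = 0 := by
  refine measureReal_exists_sitePercolatesAt_eq_zero _ _ fun m => ?_
  rw [← siteCriticalProbIOf_pyrochlore_eq m]
  exact pyrochlore_siteCriticalContinuity m

/-- Unfolded read-back down to Mathlib's `setBer`: under i.i.d. `Ber(p_c^{site})` site variables on
`pyrochloreSite = {Σmᵢ even ∧ Σ⌊mᵢ/2⌋ even} ⊂ ℤ³`, the open cluster of `m` through nearest-neighbour bonds (squared distance `2`) is a.s.
finite. [cite: BenjaminiSchramm1996, Conj. 4] -/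
theorem pyrochlore_siteCriticalContinuity_unfolded (m : pyrochloreSite) :
    (ProbabilityTheory.setBernoulli (Set.univ : Set pyrochloreSite) (siteCriticalProbIOf pyrochloreGraph m)).real
      {ξ | (siteCluster pyrochloreGraph ξ m).Infinite} = 0 :=
  pyrochlore_siteCriticalContinuity m

end Summit.CriticalPhenomena.PercolationContinuityZ3.Theorems.Transplant

end
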